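import Literature.NumberTheory.EllipticCurves.LegendreSemistableReductionProofs
import Mathlib.NumberTheory.RamificationInertia.Valuation
import Mathlib.NumberTheory.NumberField.Basic
import Mathlib.FieldTheory.IsAlgClosed.AlgebraicClosure
import HarnessLib

/-!
# [IUTchIV] Prop. 1.8 (vi), second sentence, in real form: the Legendre equation becomes
# semi-stable over an extension of degree `≤ 2` at every place of odd residue characteristic, and
# good reduction there already happens over the ground field (Silverman *AEC* VII.5.4 (c))

`Proofs` file (theorems only; no definitions, no named facts, no instances), topic
`NumberTheory/EllipticCurves`; sequel of `LegendreSemistableReductionProofs` (the case analysis of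
Silverman *AEC* Prop. VII.5.4 (c) for `y² = x(x − 1)(x − λ)` over the fraction field of a Dedekind
domain at a place `v` with `|2|_v = 1`: good iff `λ, λ − 1` are `v`-units, multiplicative if
`λ ≡ 0, 1`, `|j|_v > 1` if `λ ∉ O_v`, multiplicative if `λ ∉ O_v` and `√λ ∈ K`). Written by the cell
`abc-iut` (seat abc-iut-w5-d231), DAG node `IUTchIV:Prop1.8(vi)`, as the REAL (number-field,
Weierstrass-equation) form of the second sentence of

> S. Mochizuki, *Inter-universal Teichmüller theory IV*, Prop. 1.8 (vi) (kurims Apr-2020 manuscript,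
> p. 19): "… Then `E_k̄` descends to an elliptic curve `E_k` over `k` which is defined by means of the
> Legendre form of the Weierstrass equation. If, moreover, `k` is a complete discrete valuation field
> with algebraically closed residue field such that `2` is invertible in `O_k`, then `E_k` has
> semi-stable reduction over `O_{k′}` … for some finite extension `k′ ⊆ k̄` of `k` such that
> `[k′ : k] ≤ 2`; if `E_k` has good reduction over `O_{k′}` …, then one may in fact take `k′` to be `k`."

(printed proof p. 21: "follows from [the proof of] [Silv], Chapter VII, Proposition 5.4, (c)"), here
for the Legendre equation `⟨0, −(1 + λ), 0, λ, 0⟩` over the fraction field `K` of a Dedekind domain `A`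
at a height-one prime `v` with `|2|_v = 1`, and the primes `w ∣ v` of a Dedekind domain `B` with fraction
field `L ⊇ K` (Mathlib's `AKLB` setting of `valuation_liesOver`; the tree's reduction predicates are
attached to equations over `Frac A` at height-one primes, so `A = O_k` a complete DVR is the printed local
statement and `A = 𝓞 K` the number-field one); the existence of the degree-`≤ 2` extension is assembled
for number fields (`K′ = K(√λ) ⊆ K̄`, `B = 𝓞 K′`):

* `legendre_baseChange` — `(y² = x(x−1)(x−λ)).baseChange L` is the Legendre equation of `λ ∈ L`;
* `legendre_isSemistableAt_baseChange_of_sq_eq` — **semi-stable over `K(√λ)`**: if `d² = λ` in `L`,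
  then at every `w ∣ v` the base change has good or multiplicative reduction (`|λ|_w ≤ 1`: Cases (1)/(2) over
  `L`; `|λ|_w > 1`: Case (3), `u = d`) — stated for any `AKLB` tower of Dedekind domains, so that it
  covers number fields and complete discrete valuation fields alike;
* `legendre_hasGoodReductionAt_baseChange_iff` — **"one may in fact take `k′` to be `k`"**: for ANY
  finite extension `L/K` and `w ∣ v`, the base change has good reduction at `w` iff the equation has
  good reduction at `v` over `K` (both say `|λ| = |λ − 1| = 1`, and `|x|_w = |x|_v^{e(w|v)}`);
* **`legendre_exists_isSemistableAt_of_finrank_le_two`** — the printed sentence: there is a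
  subextension `K′ = K(√λ) ⊆ K̄` with `[K′ : K] ≤ 2` over which the Legendre equation is semi-stable at
  every place above `v` (and, by the previous item, good reduction above `v` over `K′` forces good
  reduction at `v` over `K`).

Classical and undisputed (Silverman *AEC* VII.5.4 (c)); nothing here bears on [IUTchIII] Cor. 3.12.

## References

* [SilvermanAEC2009] J. H. Silverman, *The Arithmetic of Elliptic Curves*, 2nd ed., GTM 106,
  Springer 2009: Prop. VII.5.4 (c) and its proof (PDF pp. 176–177).
* [Mochizuki2012] S. Mochizuki, *Inter-universal Teichmüller theory IV*, Prop. 1.8 (vi) p. 19, proof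
  p. 21 (kurims Apr-2020 manuscript).
-/

noncomputable section

open IsDedekindDomain NumberField

open scoped NumberField

namespace Literature.NumberTheory.EllipticCurves

open _root_.WeierstrassCurve

/-! ### Base change of the Legendre equation -/

section BaseChange

variable {K : Type*} [Field K] (L : Type*) [Field L] [Algebra K L]

/-- The base change of the Legendre equation of `λ ∈ K` to `L` is the Legendre equation of `λ ∈ L`.
[cite: SilvermanAEC2009, Prop. III.1.7] -/
theorem legendre_baseChange (la : K) :
    (⟨0, -(1 + la), 0, la, 0⟩ : WeierstrassCurve K).baseChange L =
      ⟨0, -(1 + algebraMap K L la), 0, algebraMap K L la, 0⟩ := by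
  ext <;> simp [WeierstrassCurve.baseChange, WeierstrassCurve.map]

/-- The Legendre equation of `λ` stays an elliptic curve after base change (`λ ≠ 0, 1` is preserved by
the ring map `K → L`, as is `Δ ≠ 0`). [cite: SilvermanAEC2009, Prop. III.1.7] -/
theorem legendre_isElliptic_algebraMap {la : K}
    [hE : (⟨0, -(1 + la), 0, la, 0⟩ : WeierstrassCurve K).IsElliptic] :
    (⟨0, -(1 + algebraMap K L la), 0, algebraMap K L la, 0⟩ : WeierstrassCurve L).IsElliptic := by
  have h : ((⟨0, -(1 + la), 0, la, 0⟩ : WeierstrassCurve K).baseChange L).IsElliptic := by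
    rw [WeierstrassCurve.baseChange]; infer_instance
  rwa [legendre_baseChange] at h

end BaseChange

/-! ### Places `w ∣ v` of a finite extension: `|x|_w = |x|_v^{e(w∣v)}` -/

section LiesOver

/- The `AKLB` setting of Mathlib's `IsDedekindDomain.HeightOneSpectrum.valuation_liesOver`: `A ⊆ K`,
`B ⊆ L` Dedekind domains with their fraction fields, `L/K` an extension, `B` an `A`-algebra compatibly,
`w` a height-one prime of `B` over the height-one prime `v` of `A`. Number fields (`A = 𝓞 K`, `B = 𝓞 L`)
and complete discrete valuation fields (`A = O_k`, `B` its integral closure in `k′`) are instances. -/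
variable {A K : Type*} (L : Type*) {B : Type*} [CommRing A] [IsDedekindDomain A] [CommRing B]
  [IsDedekindDomain B] [Algebra A B] [Module.IsTorsionFree A B] [Field K] [Field L] [Algebra K L]
  [Algebra A K] [IsFractionRing A K] [Algebra A L] [IsScalarTower A K L] [Algebra B L]
  [IsFractionRing B L] [IsScalarTower A B L] {v : HeightOneSpectrum A} {w : HeightOneSpectrum B}

/-- `|x|_w = |x|_v ^ e(w ∣ v)` with `e(w ∣ v) ≥ 1`, hence `|x|_w ≤ 1 ↔ |x|_v ≤ 1`, for `w ∣ v`
(Mathlib `IsDedekindDomain.HeightOneSpectrum.valuation_liesOver`).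
[cite: SilvermanAEC2009, VII.5.4 (proof, valuations over an extension)] -/
theorem valuation_algebraMap_le_one_iff [w.asIdeal.LiesOver v.asIdeal] (x : K) :
    w.valuation L (algebraMap K L x) ≤ 1 ↔ v.valuation K x ≤ 1 := by
  have he : v.asIdeal.ramificationIdx' w.asIdeal ≠ 0 :=
    Ideal.IsDedekindDomain.ramificationIdx'_ne_zero_of_liesOver w.asIdeal v.ne_bot
  rw [← HeightOneSpectrum.valuation_liesOver L v w]
  refine ⟨fun h ↦ ?_, fun h ↦ pow_le_one₀ zero_le h⟩
  by_contra hlt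
  exact (one_lt_pow₀ (not_le.mp hlt) he).not_ge h

/-- `|x|_w = |x|_v ^ e(w ∣ v)` with `e(w ∣ v) ≥ 1`, hence `|x|_w = 1 ↔ |x|_v = 1`, for `w ∣ v`.
[cite: SilvermanAEC2009, VII.5.4 (proof, valuations over an extension)] -/
theorem valuation_algebraMap_eq_one_iff [w.asIdeal.LiesOver v.asIdeal] (x : K) :
    w.valuation L (algebraMap K L x) = 1 ↔ v.valuation K x = 1 := by
  have he : v.asIdeal.ramificationIdx' w.asIdeal ≠ 0 :=
    Ideal.IsDedekindDomain.ramificationIdx'_ne_zero_of_liesOver w.asIdeal v.ne_bot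
  rw [← HeightOneSpectrum.valuation_liesOver L v w]
  refine ⟨fun h ↦ ?_, fun h ↦ by rw [h, one_pow]⟩
  rcases lt_trichotomy (v.valuation K x) 1 with hlt | heq | hgt
  · exact absurd h (pow_lt_one₀ zero_le hlt he).ne
  · exact heq
  · exact absurd h (one_lt_pow₀ hgt he).ne'

/-- `|x|_w = |x|_v ^ e(w ∣ v)` with `e(w ∣ v) ≥ 1`, hence `1 < |x|_w ↔ 1 < |x|_v`, for `w ∣ v`.
[cite: SilvermanAEC2009, VII.5.4 (proof, valuations over an extension)] -/
theorem one_lt_valuation_algebraMap_iff [w.asIdeal.LiesOver v.asIdeal] (x : K) :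
    1 < w.valuation L (algebraMap K L x) ↔ 1 < v.valuation K x := by
  rw [← not_le, valuation_algebraMap_le_one_iff L (v := v) (w := w), not_le]

/-- `|2|_w = 1` at every `w ∣ v` when `|2|_v = 1`. [cite: SilvermanAEC2009, VII.5.4 (proof)] -/
theorem valuation_two_eq_one_of_liesOver [w.asIdeal.LiesOver v.asIdeal]
    (h2 : v.valuation K (2 : K) = 1) : w.valuation L (2 : L) = 1 := by
  have h := (valuation_algebraMap_eq_one_iff L (v := v) (w := w) (2 : K)).mpr h2
  rwa [map_ofNat] at h

variable {L}

/-- **[IUTchIV] Prop. 1.8 (vi), second sentence — semi-stable reduction over `K(√λ)`.** Let `v` be a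
finite place of `K = Frac A` with `|2|_v = 1`, `λ ∈ K ∖ {0, 1}`, `L/K` an extension containing `d` with
`d² = λ`, and `w ∣ v` a place of `L = Frac B`. Then `y² = x(x − 1)(x − λ)` has SEMI-STABLE (good or
multiplicative) reduction at `w` over `L`: if `|λ|_w ≤ 1` this is Silverman's Cases (1)/(2), if
`|λ|_w > 1` the substitution `u = d` gives the Legendre equation of `λ⁻¹ ∈ 𝔪_w`, Case (3). Silverman,
*AEC*, Prop. VII.5.4 (c); [IUTchIV] Prop. 1.8 (vi) ("`E_k` has semi-stable reduction over `O_{k′}` for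
some … `[k′ : k] ≤ 2`" — take `k′ = k(√λ)`). [cite: SilvermanAEC2009, Prop. VII.5.4(c) and proof (PDF pp. 176–177)]
[cite: Mochizuki2012, IUTchIV Prop 1.8 (vi) p.19] -/
theorem legendre_isSemistableAt_baseChange_of_sq_eq [w.asIdeal.LiesOver v.asIdeal] {la : K}
    (h2 : v.valuation K (2 : K) = 1) [hE : (⟨0, -(1 + la), 0, la, 0⟩ : WeierstrassCurve K).IsElliptic]
    {d : L} (hd : d ^ 2 = algebraMap K L la) :
    ((⟨0, -(1 + la), 0, la, 0⟩ : WeierstrassCurve K).baseChange L).IsSemistableAt w := by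
  have h2w := valuation_two_eq_one_of_liesOver L (v := v) (w := w) h2
  haveI := legendre_isElliptic_algebraMap L (la := la)
  rw [legendre_baseChange]
  rcases le_or_gt (v.valuation K la) 1 with hle | hgt
  · exact legendre_isSemistableAt_of_valuation_le_one w h2w
      ((valuation_algebraMap_le_one_iff L (v := v) (w := w) la).mpr hle)
  · exact (legendre_hasMultiplicativeReductionAt_of_one_lt_valuation_of_sq_eq w h2w
      ((one_lt_valuation_algebraMap_iff L (v := v) (w := w) la).mpr hgt) hd).isSemistableAt

variable (L) in
/-- **[IUTchIV] Prop. 1.8 (vi), second sentence — "if `E_k` has good reduction over `O_{k′}`, then one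
may in fact take `k′` to be `k`".** For ANY extension `L/K` (`L = Frac B ⊇ K = Frac A`), `w ∣ v`,
`|2|_v = 1`, `λ ≠ 0, 1`: the Legendre equation `y² = x(x − 1)(x − λ)` has good reduction at `w` over `L`
iff it has good reduction at `v` over `K` — both are the condition "`λ` and `λ − 1` are units"
(`legendre_hasGoodReductionAt_iff`), which does not see the extension (`|x|_w = |x|_v^{e(w∣v)}`).
Silverman, *AEC*, Prop. VII.5.4 (c) (Case 1 is the only good case). [cite: SilvermanAEC2009, Prop. VII.5.4(c) and proof (PDF pp. 176–177)]
[cite: Mochizuki2012, IUTchIV Prop 1.8 (vi) p.19] -/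
theorem legendre_hasGoodReductionAt_baseChange_iff [w.asIdeal.LiesOver v.asIdeal] {la : K}
    (h2 : v.valuation K (2 : K) = 1) [hE : (⟨0, -(1 + la), 0, la, 0⟩ : WeierstrassCurve K).IsElliptic] :
    ((⟨0, -(1 + la), 0, la, 0⟩ : WeierstrassCurve K).baseChange L).HasGoodReductionAt w ↔
      (⟨0, -(1 + la), 0, la, 0⟩ : WeierstrassCurve K).HasGoodReductionAt v := by
  have h2w := valuation_two_eq_one_of_liesOver L (v := v) (w := w) h2
  haveI := legendre_isElliptic_algebraMap L (la := la)
  rw [legendre_baseChange, legendre_hasGoodReductionAt_iff w h2w, legendre_hasGoodReductionAt_iff v h2,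
    show algebraMap K L la - 1 = algebraMap K L (la - 1) by rw [map_sub, map_one],
    valuation_algebraMap_eq_one_iff L (v := v) (w := w),
    valuation_algebraMap_eq_one_iff L (v := v) (w := w)]

end LiesOver

/-! ### The printed sentence for number fields: `K′ = K(√λ)`, `[K′ : K] ≤ 2` -/

section NumberField

variable {K : Type*} [Field K] [NumberField K] {v : HeightOneSpectrum (𝓞 K)}

/-- **[IUTchIV] Prop. 1.8 (vi), second sentence, assembled: `[k′ : k] ≤ 2`.** Let `K` be a number field,
`v` a finite place with `|2|_v = 1` and `λ ∈ K ∖ {0, 1}`. Then there is a subextension `K′ ⊆ K̄` of `K`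
(namely `K(√λ)`), a number field with `[K′ : K] ≤ 2`, such that the Legendre curve
`y² = x(x − 1)(x − λ)` has semi-stable reduction at EVERY place of `K′` above `v`. (With
`legendre_hasGoodReductionAt_baseChange_iff`: if the reduction above `v` over `K′` is good, it is
already good at `v` over `K` — "one may in fact take `k′` to be `k`".) Silverman, *AEC*,
Prop. VII.5.4 (c); S. Mochizuki, [IUTchIV] Prop. 1.8 (vi), second sentence (proof p. 21 citing
[Silv] VII Prop. 5.4 (c)). [cite: SilvermanAEC2009, Prop. VII.5.4(c) and proof (PDF pp. 176–177)]
[cite: Mochizuki2012, IUTchIV Prop 1.8 (vi) p.19] -/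
theorem legendre_exists_isSemistableAt_of_finrank_le_two {la : K} (h2 : v.valuation K (2 : K) = 1)
    [hE : (⟨0, -(1 + la), 0, la, 0⟩ : WeierstrassCurve K).IsElliptic] :
    ∃ (E : IntermediateField K (AlgebraicClosure K)) (_ : NumberField E),
      Module.finrank K E ≤ 2 ∧
        ∀ w : HeightOneSpectrum (𝓞 E), w.asIdeal.under (𝓞 K) = v.asIdeal →
          ((⟨0, -(1 + la), 0, la, 0⟩ : WeierstrassCurve K).baseChange E).IsSemistableAt w := by
  set Kbar := AlgebraicClosure K
  -- a square root of `λ` in `K̄` and the field `K(√λ)`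
  obtain ⟨d, hd⟩ := IsAlgClosed.exists_pow_nat_eq (algebraMap K Kbar la) two_pos
  have hint : IsIntegral K d := Algebra.IsIntegral.isIntegral d
  set E : IntermediateField K Kbar := IntermediateField.adjoin K {d} with hEdef
  haveI hF : FiniteDimensional K E := IntermediateField.adjoin.finiteDimensional hint
  haveI hNF : NumberField E := NumberField.of_module_finite K E
  refine ⟨E, hNF, ?_, fun w hw ↦ ?_⟩
  · -- `[K(√λ) : K] = deg (minpoly d) ≤ deg (X² − λ) = 2`
    rw [hEdef, IntermediateField.adjoin.finrank hint]
    have hroot : Polynomial.aeval d (Polynomial.X ^ 2 - Polynomial.C la : Polynomial K) = 0 := by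
      simp [hd]
    have hne : (Polynomial.X ^ 2 - Polynomial.C la : Polynomial K) ≠ 0 :=
      Polynomial.X_pow_sub_C_ne_zero two_pos la
    calc (minpoly K d).natDegree ≤ (Polynomial.X ^ 2 - Polynomial.C la : Polynomial K).natDegree :=
          Polynomial.natDegree_le_of_dvd (minpoly.dvd K d hroot) hne
      _ = 2 := Polynomial.natDegree_X_pow_sub_C
  · -- `√λ ∈ K(√λ)`
    haveI : w.asIdeal.LiesOver v.asIdeal := ⟨hw.symm⟩
    have hdE : d ∈ E := IntermediateField.mem_adjoin_simple_self K d
    refine legendre_isSemistableAt_baseChange_of_sq_eq (v := v) h2 (d := (⟨d, hdE⟩ : E)) ?_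
    apply Subtype.ext
    change d ^ 2 = ((algebraMap K E la : E) : Kbar)
    rw [hd]
    exact (IsScalarTower.algebraMap_apply K E Kbar la)

end NumberField

end Literature.NumberTheory.EllipticCurves

end
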